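import Summits.BirchSwinnertonDyer.BirchSwinnertonDyer.Theorems.ByReductionTypeAtTwoMultTowerLocalAddv
import Literature.NumberTheory.EllipticCurves.KodairaNeronUnramifiedAdditiveBoundProofs
import HarnessLib

/-!
# Route `ByReductionTypeAtTwo`, crux `MultUpperHalfAtTwo` (item stmt-BirchSwinnertonDyer-19922): ONE BIT at an odd ADDITIVE prime of
# POTENTIALLY GOOD type — part 1: `[J(K_v^nr) : E₀] ≤ 3` for the additive Kodaira types other than `I_n*`

Part 1 of 3 (sibling of `…MultTowerLocalAddv.lean`, p505183, the ZERO-bit lever): the tree's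
`index_nonsingularReductionSubgroup_map_le_four_of_isAdditive` (`KodairaNeronUnramifiedAdditiveBoundProofs`) VERBATIM with the `I_n*` branch
excluded by hypothesis and the bound carried as `3` (*ATAEC* Table 4.1: `c̄ = 1, 2, 3, 3, 2, 1` for II, III, IV, IV*, III*, II*). Parts 2–3
(`…PotGoodInertia`, `…PotGood`) turn it into `#E(K_v^nr)[p^∞] ≤ 3` and `#𝒦_{v,n}[2^∞] ≤ 2` (ONE bit) with a decidable certificate over `ℚ`.
HONEST FRAMING (cell `bsd-2adic`, run/shared/lean/pub/bsd-2adic/, seat `bsd-2adic-mult-2` GEN 8, HUMAN RULINGS D-0036 / D-0054 /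
D-0074 row (A)): research route; THEOREMS ONLY — no definition, no new named fact; nothing is booked; BSD is not proved by any of
this. PARTITION: X5@2 mult (K4ᵐ, RESIDUAL-MAP B1·O1; the 1 680 `E[2]`-irreducible classes) × p = 2 — types-the-object-of (the per-prime
local constant of the TOWER-gap certificate of item 19922 at an odd additive prime of potentially good type); closes none.
WHAT IS DISPLAYED, NOT PROVED: nothing. ∀-LEVEL CONTENT: none.
References: R. Greenberg, LNM 1716 (1999), §3 Lemma 3.3 (pp. 86–88); J. H. Silverman, *AEC* (2009) Thm. VII.6.1; *ATAEC* (1994) IV.9.4,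
Table 4.1, Cor. IV.9.2(d).
-/

set_option autoImplicit false
-- the Theorems namespace of this sub repeats the summit name by design (D-0017 nested layout: Summit.<S>.<Sub>)
set_option linter.dupNamespace false

noncomputable section

open scoped Classical NNReal
open NumberField IsDedekindDomain Field Polynomial IsLocalRing

universe u

/-! ## §1 `[J(K_v^nr) : E₀] ≤ 3` at the potentially good additive types -/

namespace IsDedekindDomain.HeightOneSpectrum

open Literature.NumberTheory.EllipticCurves Literature.NumberTheory.EllipticCurves.LocalIndex
  Literature.NumberTheory.GaloisRepresentations
  Literature.NumberTheory.GaloisRepresentations.IsNonarchimedeanLocalField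
  Literature.NumberTheory.DiophantineGeometry Literature.NumberTheory.DiophantineGeometry.TateAlgorithm
  Literature.NumberTheory.DiophantineGeometry.KodairaSymbol

variable {K : Type u} [Field K] [NumberField K] {v : HeightOneSpectrum (𝓞 K)}
  {w : Valuation (AlgebraicClosure (v.adicCompletion K)) ℝ≥0}
  (hw : ∀ x, (w x : ℝ) = spectralNorm (v.adicCompletion K) (AlgebraicClosure (v.adicCompletion K)) x)

set_option maxHeartbeats 4000000 in
include hw in
/-- **`[J(K_v^nr) : E₀] ≤ 3` when Tate's algorithm returns an additive type OTHER THAN `I_n*` on `X₀`** (`J = X₀ ⊗ 𝒪ⁿʳ`; types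
II, III, IV, IV*, III*, II* — the potentially GOOD additive types — have `c̄ = 1, 2, 3, 3, 2, 1`, *ATAEC* Table 4.1): the tree's
`index_nonsingularReductionSubgroup_map_le_four_of_isAdditive` VERBATIM (type-by-type index computations on the normal form of the type)
with the `I_n*` branch excluded by hypothesis and the bound carried as `3`. [cite: SilvermanAEC2009, Thm. VII.6.1 (PDF p. 177)]
[cite: SilvermanATAEC1994, Cor. IV.9.2(d) with IV.9.4 and Table 4.1 (PDF pp. 340–346, 365)] -/
theorem index_nonsingularReductionSubgroup_map_le_three_of_isAdditive_of_ne_Istar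
    [IsDiscreteValuationRing (Valuation.valuationSubring (Valuation.comap (algebraMap (maxUnramified (v.adicCompletion K)) (AlgebraicClosure (v.adicCompletion K))) w))] [HenselianLocalRing (Valuation.valuationSubring (Valuation.comap (algebraMap (maxUnramified (v.adicCompletion K)) (AlgebraicClosure (v.adicCompletion K))) w))]
    {φ : (v.adicCompletionIntegers K) →+* (Valuation.valuationSubring (Valuation.comap (algebraMap (maxUnramified (v.adicCompletion K)) (AlgebraicClosure (v.adicCompletion K))) w))} (hφ : ∀ a, (((φ a : (Valuation.valuationSubring (Valuation.comap (algebraMap (maxUnramified (v.adicCompletion K)) (AlgebraicClosure (v.adicCompletion K))) w))) : (maxUnramified (v.adicCompletion K))) : (AlgebraicClosure (v.adicCompletion K))) = algebraMap (v.adicCompletion K) (AlgebraicClosure (v.adicCompletion K)) (a : (v.adicCompletion K)))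
    (X₀ : WeierstrassCurve (v.adicCompletionIntegers K)) (hΔ : X₀.Δ ≠ 0) (hs : X₀.kodairaSymbolOfMinimal.IsAdditive)
    (hpg : ∀ n, X₀.kodairaSymbolOfMinimal ≠ .Istar n) :
    letI : DecidableEq (maxUnramified (v.adicCompletion K)) := fun a b ↦ Classical.propDecidable (a = b)
    ((X₀.map φ).nonsingularReductionSubgroup (integers_valuationRing_valuation (Valuation.valuationSubring (Valuation.comap (algebraMap (maxUnramified (v.adicCompletion K)) (AlgebraicClosure (v.adicCompletion K))) w)) (maxUnramified (v.adicCompletion K)))).index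
      ≤ 3 := by
  letI instDec : DecidableEq (maxUnramified (v.adicCompletion K)) := fun a b ↦ Classical.propDecidable (a = b)
  haveI : PerfectField (ResidueField (v.adicCompletionIntegers K)) := PerfectField.ofFinite
  have hvR := integers_valuationRing_valuation (Valuation.valuationSubring (Valuation.comap (algebraMap (maxUnramified (v.adicCompletion K)) (AlgebraicClosure (v.adicCompletion K))) w)) (maxUnramified (v.adicCompletion K))
  have hinjR := IsFractionRing.injective (Valuation.valuationSubring (Valuation.comap (algebraMap (maxUnramified (v.adicCompletion K)) (AlgebraicClosure (v.adicCompletion K))) w)) (maxUnramified (v.adicCompletion K))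
  show ((X₀.map φ).nonsingularReductionSubgroup hvR).index ≤ 3
  -- transfer of the `π`-adic conditions
  have T : ∀ (a : (v.adicCompletionIntegers K)) (k : ℕ), a ∈ maximalIdeal (v.adicCompletionIntegers K) ^ k → φ a ∈ maximalIdeal (Valuation.valuationSubring (Valuation.comap (algebraMap (maxUnramified (v.adicCompletion K)) (AlgebraicClosure (v.adicCompletion K))) w)) ^ k :=
    fun a k h ↦ (map_mem_maximalIdeal_pow_iff hw hφ a k).mpr h
  have T1 : ∀ a : (v.adicCompletionIntegers K), a ∈ maximalIdeal (v.adicCompletionIntegers K) → φ a ∈ maximalIdeal (Valuation.valuationSubring (Valuation.comap (algebraMap (maxUnramified (v.adicCompletion K)) (AlgebraicClosure (v.adicCompletion K))) w)) :=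
    fun a h ↦ (map_mem_maximalIdeal_iff hw hφ a).mpr h
  have N : ∀ (a : (v.adicCompletionIntegers K)) (k : ℕ), a ∉ maximalIdeal (v.adicCompletionIntegers K) ^ k → φ a ∉ maximalIdeal (Valuation.valuationSubring (Valuation.comap (algebraMap (maxUnramified (v.adicCompletion K)) (AlgebraicClosure (v.adicCompletion K))) w)) ^ k :=
    fun a k h h' ↦ h ((map_mem_maximalIdeal_pow_iff hw hφ a k).mp h')
  have hΔφ : ∀ D : WeierstrassCurve.VariableChange (v.adicCompletionIntegers K), ((D • X₀).map φ).Δ ≠ 0 := fun D h0 ↦ by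
    rw [WeierstrassCurve.map_Δ, WeierstrassCurve.variableChange_Δ, map_mul,
      mul_eq_zero] at h0
    rcases h0 with h0 | h0
    · exact (((D.u⁻¹ ^ 12).isUnit.map φ).ne_zero) (by simpa using h0)
    · exact hΔ (injective_of_coe_eq_algebraMap hφ (by rw [h0, map_zero]))
  have hidx : ∀ D : WeierstrassCurve.VariableChange (v.adicCompletionIntegers K),
      (((D • X₀).map φ).nonsingularReductionSubgroup hvR).index =
      ((X₀.map φ).nonsingularReductionSubgroup hvR).index := fun D ↦ by
    rw [← WeierstrassCurve.map_variableChange]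
    exact index_nonsingularReductionSubgroup_smul (X₀.map φ) (D.map φ)
  have hall : ∀ J : WeierstrassCurve (Valuation.valuationSubring (Valuation.comap (algebraMap (maxUnramified (v.adicCompletion K)) (AlgebraicClosure (v.adicCompletion K))) w)),
      (∀ a b : (Valuation.valuationSubring (Valuation.comap (algebraMap (maxUnramified (v.adicCompletion K)) (AlgebraicClosure (v.adicCompletion K))) w)), J.toAffine.Equation a b →
        ¬ (J.map (residue (Valuation.valuationSubring (Valuation.comap (algebraMap (maxUnramified (v.adicCompletion K)) (AlgebraicClosure (v.adicCompletion K))) w)))).toAffine.Nonsingular (residue (Valuation.valuationSubring (Valuation.comap (algebraMap (maxUnramified (v.adicCompletion K)) (AlgebraicClosure (v.adicCompletion K))) w)) a) (residue (Valuation.valuationSubring (Valuation.comap (algebraMap (maxUnramified (v.adicCompletion K)) (AlgebraicClosure (v.adicCompletion K))) w)) b) → False) →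
      (J.nonsingularReductionSubgroup hvR).index = 1 := by
    intro J hJ
    rw [AddSubgroup.index_eq_one, eq_top_iff]
    intro P _
    rw [WeierstrassCurve.mem_nonsingularReductionSubgroup_iff]
    rcases point_cases hvR P with rfl | ⟨x, y, h, rfl, hx⟩ | ⟨a, b, h, rfl⟩
    · trivial
    · exact Or.inl ((not_mem_range_iff hvR).mpr hx)
    · refine (WeierstrassCurve.hasNonsingularReduction_some_algebraMap_iff hinjR h).mpr ?_
      have he : J.toAffine.Equation a b :=
        (WeierstrassCurve.Affine.map_equation _ hinjR a b).mp h.left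
      by_contra hns
      exact hJ a b he hns
  generalize hs' : X₀.kodairaSymbolOfMinimal = s at hs
  cases s with
  | I n =>
    exfalso
    rcases Nat.eq_zero_or_pos n with rfl | hn
    · exact hs.1 rfl
    · exact hs.2 ⟨n, hn.ne', rfl⟩
  | II =>
    obtain ⟨hΔm, -, ha₆⟩ := kodairaSymbolOfMinimal_eq_II_imp X₀ hs'
    have hex := exists_variableChange_step2_of_perfectField X₀ hΔm
    rw [show normalizeStep2 X₀ = hex.choose • X₀ from dif_pos hex] at ha₆
    obtain ⟨-, h3, h4, h6⟩ := hex.choose_spec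
    have key := hall ((hex.choose • X₀).map φ) fun a b he hns ↦ by
      obtain ⟨ha, hb⟩ := mem_maximalIdeal_of_not_nonsingular (T1 _ h3) (T1 _ h4) (T1 _ h6) he hns
      exact N _ 2 ha₆ (a₆_mem_sq_of_equation (T1 _ h3) (T1 _ h4) he ha hb)
    rw [hidx] at key
    omega
  | III =>
    obtain ⟨D, h1, h2, h3, h4, h4', h6⟩ := exists_smul_of_kodairaSymbolOfMinimal_eq_III X₀ hs'
    have key := index_eq_two_of_normalForm_III (K := (maxUnramified (v.adicCompletion K))) ((D • X₀).map φ) (hΔφ D) (T1 _ h1)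
      (T1 _ h2) (T1 _ h3) (T1 _ h4) (N _ 2 h4') (T _ 2 h6)
    rw [hidx] at key
    omega
  | IV =>
    obtain ⟨D, h1, h2, h3, h4, h6, hb₆⟩ := exists_smul_of_kodairaSymbolOfMinimal_eq_IV X₀ hs'
    have hb₆' : ((D • X₀).map φ).b₆ ∉ maximalIdeal (Valuation.valuationSubring (Valuation.comap (algebraMap (maxUnramified (v.adicCompletion K)) (AlgebraicClosure (v.adicCompletion K))) w)) ^ 3 := by
      rw [WeierstrassCurve.map_b₆]; exact N _ 3 hb₆
    have key := index_mem_of_normalForm_IV (K := (maxUnramified (v.adicCompletion K))) ((D • X₀).map φ) (T1 _ h1) (T1 _ h2)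
      (T1 _ h3) (T _ 2 h4) (T _ 2 h6) hb₆'
    rw [hidx] at key
    omega
  | Istar n => exact absurd hs' (hpg n)
  | IVstar =>
    obtain ⟨D, h1, h2, h3, h4, h6, h8⟩ := exists_smul_of_kodairaSymbolOfMinimal_eq_IVstar X₀ hs'
    have h8' := distinctRootCount_quadraticStep8_map_eq_two hw hφ (D • X₀) h3 h6 h8
    have key := index_mem_of_normalForm_IVstar (K := (maxUnramified (v.adicCompletion K))) ((D • X₀).map φ) (T1 _ h1) (T _ 2 h2)
      (T _ 2 h3) (T _ 3 h4) (T _ 4 h6) h8'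
    rw [hidx] at key
    omega
  | IIIstar =>
    obtain ⟨D, h1, h2, h3, h4, h4', h6⟩ :=
      exists_smul_of_kodairaSymbolOfMinimal_eq_IIIstar X₀ hs'
    have key := index_eq_two_of_normalForm_IIIstar (K := (maxUnramified (v.adicCompletion K))) ((D • X₀).map φ) (hΔφ D) (T1 _ h1)
      (T _ 2 h2) (T _ 3 h3) (T _ 3 h4) (N _ 4 h4') (T _ 5 h6)
    rw [hidx] at key
    omega
  | IIstar =>
    obtain ⟨D, h1, h2, h3, h4, h6, h6'⟩ := exists_smul_of_kodairaSymbolOfMinimal_eq_IIstar X₀ hs'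
    have key := hall ((D • X₀).map φ) fun a b he hns ↦ by
      obtain ⟨ha, hb⟩ := mem_maximalIdeal_of_not_nonsingular
        (Ideal.pow_le_self three_ne_zero (T _ 3 h3))
        (Ideal.pow_le_self four_ne_zero (T _ 4 h4)) (Ideal.pow_le_self (by norm_num) (T _ 5 h6))
        he hns
      apply N _ 6 h6'
      have hd := dvd_a₆_of_equation_IIstar (irreducible_uniformizer (R := (Valuation.valuationSubring (Valuation.comap (algebraMap (maxUnramified (v.adicCompletion K)) (AlgebraicClosure (v.adicCompletion K))) w))))
        (mem_maximalIdeal_iff_dvd.mp (T1 _ h1)) (mem_maximalIdeal_pow_iff_dvd.mp (T _ 2 h2))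
        (mem_maximalIdeal_pow_iff_dvd.mp (T _ 3 h3)) (mem_maximalIdeal_pow_iff_dvd.mp (T _ 4 h4))
        (mem_maximalIdeal_pow_iff_dvd.mp (T _ 5 h6)) he (mem_maximalIdeal_iff_dvd.mp ha)
        (mem_maximalIdeal_iff_dvd.mp hb)
      exact mem_maximalIdeal_pow_iff_dvd.mpr hd
    rw [hidx] at key
    omega


end IsDedekindDomain.HeightOneSpectrum

end
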